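import Mathlib.NumberTheory.Cyclotomic.PrimitiveRoots
import Mathlib.RingTheory.Polynomial.Cyclotomic.Roots
import Mathlib.LinearAlgebra.Dimension.OrzechProperty
import Mathlib.LinearAlgebra.Dimension.Constructions
import HarnessLib

/-!
# Monomials `ω^r ζ^s` in roots of unity of coprime orders `2m = 2^{a+1}` and `q` (an odd prime) are `ℚ`-linearly
# independent

COR-CM (cell `pub-hodgecm2`), binder seat b04 (gen 11), count-neutral; linear-algebra input of
`CorCM/CyclicTimesPrimeCMTypes` (CM fields with cyclic Galois group of order `2^{a+1} q`).  KERNEL ONLY: theorems;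
no definition, no named fact, no `sorry`.

For `ω, ζ ∈ ℂ` with `ω^m = -1`, `m = 2^a`, and `ζ` a primitive `q`-th root of unity, `q` an odd prime, the
`m (q-1) = φ(2m) φ(q) = φ(2mq)` monomials `ω^r ζ^s` (`r < m`, `s < q - 1`) span the `ℚ`-algebra `ℚ[ωζ] = ℚ(ζ_{2mq})`
(`ωζ` is a primitive `2mq`-th root of unity; `ω^{r+m} = -ω^r`, `ζ^{q-1} = -Σ_{s<q-1} ζ^s`), of dimension `φ(2mq)`
(irreducibility of `Φ_{2mq}` over `ℚ`); hence they are LINEARLY INDEPENDENT (`linearIndependent_monomials`), and a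
relation `Σ_{r<m} Σ_{s<q} c_{rs} ω^r ζ^s = 0` forces `s ↦ c_{rs}` to be CONSTANT for every `r`
(`forall_eq_of_sum_monomials_eq_zero`): the only relation among the `q`-th roots of unity over `ℚ(ζ_{2m})` is
`Σ_s ζ^s = 0` (linear disjointness of `ℚ(ζ_{2m})` and `ℚ(ζ_q)`).

## References

* [Washington1997] L. C. Washington, *Introduction to Cyclotomic Fields*, Prop. 2.4, Thm. 2.5 (degrees multiply for
  coprime conductors).
* [Lang2002Algebra] S. Lang, *Algebra*, VI §3 (cyclotomic fields, linear disjointness).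
-/

noncomputable section

open Polynomial Module

namespace Summit.HodgeConjecture.CorCM.CyclicTwoPower

section Monomials

variable {ω ζ : ℂ} {m q a : ℕ}

/-- Every monomial `ω^i ζ^j` lies in the `ℚ`-span of the basic ones `ω^r ζ^s`, `r < m`, `s < q - 1`
(`ω^{2m} = 1`, `ω^{r+m} = -ω^r`; `ζ^q = 1`, `ζ^{q-1} = -Σ_{s<q-1} ζ^s`). [folklore] -/
theorem pow_mul_pow_mem_span (hω : ω ^ m = -1) (hm : 0 < m) (hζ : IsPrimitiveRoot ζ q) (hq : 1 < q)
    (i j : ℕ) :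
    ω ^ i * ζ ^ j ∈ Submodule.span ℚ (Set.range fun rs : Fin m × Fin (q - 1) =>
      ω ^ (rs.1 : ℕ) * ζ ^ (rs.2 : ℕ)) := by
  set V := Submodule.span ℚ (Set.range fun rs : Fin m × Fin (q - 1) => ω ^ (rs.1 : ℕ) * ζ ^ (rs.2 : ℕ))
    with hV
  have hbasic : ∀ r < m, ∀ s < q - 1, ω ^ r * ζ ^ s ∈ V := fun r hr s hs =>
    Submodule.subset_span ⟨(⟨r, hr⟩, ⟨s, hs⟩), rfl⟩
  -- the top power of `ζ`
  have hζtop : ζ ^ (q - 1) = -∑ s ∈ Finset.range (q - 1), ζ ^ s := by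
    have h := hζ.geom_sum_eq_zero hq
    rw [show q = (q - 1) + 1 by omega, Finset.sum_range_succ] at h
    linear_combination h
  have hstep1 : ∀ r < m, ∀ s < q, ω ^ r * ζ ^ s ∈ V := by
    intro r hr s hs
    rcases Nat.lt_or_ge s (q - 1) with hs' | hs'
    · exact hbasic r hr s hs'
    · rw [show s = q - 1 by omega, hζtop, mul_neg, Finset.mul_sum]
      exact V.neg_mem (V.sum_mem fun i hi => hbasic r hr i (Finset.mem_range.1 hi))
  -- reduce the exponents
  have hζq : ζ ^ q = 1 := hζ.pow_eq_one
  have hω2m : ω ^ (2 * m) = 1 := by rw [mul_comm, pow_mul, hω]; norm_num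
  have hstep2 : ∀ r < 2 * m, ∀ s < q, ω ^ r * ζ ^ s ∈ V := by
    intro r hr s hs
    rcases Nat.lt_or_ge r m with hr' | hr'
    · exact hstep1 r hr' s hs
    · have : ω ^ r = -(ω ^ (r - m)) := by
        rw [show r = (r - m) + m by omega, pow_add, hω, Nat.add_sub_cancel]; ring
      rw [this, neg_mul]
      exact V.neg_mem (hstep1 _ (by omega) s hs)
  rw [pow_eq_pow_mod i hω2m, pow_eq_pow_mod j hζq]
  exact hstep2 _ (Nat.mod_lt _ (by omega)) _ (Nat.mod_lt _ (by omega))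

/-- **The basic monomials `ω^r ζ^s` (`r < m = 2^a`, `s < q - 1`) are `ℚ`-linearly independent** for `ω^m = -1` and
`ζ` a primitive `q`-th root of unity, `q` an odd prime: they span `ℚ[ωζ]`, `ωζ` a primitive `2mq`-th root of unity,
a `ℚ`-space of dimension `φ(2mq) = m (q - 1)`. [cite: Washington1997, Prop. 2.4 and Thm. 2.5] -/
theorem linearIndependent_monomials (hm : m = 2 ^ a) (hω : ω ^ m = -1) (hq : q.Prime) (hq2 : q ≠ 2)
    (hζ : IsPrimitiveRoot ζ q) :
    LinearIndependent ℚ (fun rs : Fin m × Fin (q - 1) => ω ^ (rs.1 : ℕ) * ζ ^ (rs.2 : ℕ)) := by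
  classical
  have hm0 : 0 < m := by rw [hm]; positivity
  have hq1 : 1 < q := hq.one_lt
  -- `ω` is a primitive `2m`-th root of unity
  have hω2m : ω ^ (2 * m) = 1 := by rw [mul_comm, pow_mul, hω]; norm_num
  have hωprim : IsPrimitiveRoot ω (2 * m) := by
    rw [IsPrimitiveRoot.iff_orderOf]
    have hdvd : orderOf ω ∣ 2 * m := orderOf_dvd_of_pow_eq_one hω2m
    have h2m : 2 * m = 2 ^ (a + 1) := by rw [hm, pow_succ, mul_comm]
    rw [h2m] at hdvd ⊢
    obtain ⟨j, hj, hjeq⟩ := (Nat.dvd_prime_pow Nat.prime_two).1 hdvd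
    rw [hjeq]
    rcases Nat.lt_or_ge j (a + 1) with hlt | hge
    · exfalso
      have h1 : ω ^ (2 ^ a) = 1 := by
        have : 2 ^ j ∣ 2 ^ a := Nat.pow_dvd_pow 2 (by omega)
        obtain ⟨c, hc⟩ := this
        rw [hc, pow_mul, ← hjeq, pow_orderOf_eq_one, one_pow]
      rw [← hm, hω] at h1
      norm_num at h1
    · have : j = a + 1 := le_antisymm hj hge
      rw [this]
  -- `η = ω ζ` is a primitive `2mq`-th root of unity
  have hcop : (2 * m).Coprime q := by
    rw [hm, show 2 * 2 ^ a = 2 ^ (a + 1) by ring]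
    exact (Nat.Coprime.pow_left _ ((Nat.coprime_primes Nat.prime_two hq).2 (Ne.symm hq2)))
  have hη : IsPrimitiveRoot (ω * ζ) (2 * m * q) := by
    rw [IsPrimitiveRoot.iff_orderOf, (Commute.all ω ζ).orderOf_mul_eq_mul_orderOf_of_coprime
      (by rwa [← hωprim.eq_orderOf, ← hζ.eq_orderOf]), ← hωprim.eq_orderOf, ← hζ.eq_orderOf]
  haveI : NeZero (2 * m * q) := ⟨by positivity⟩
  -- the subalgebra `ℚ[η]` and its dimension
  set A := Algebra.adjoin ℚ ({ω * ζ} : Set ℂ) with hA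
  haveI := hη.adjoin_isCyclotomicExtension ℚ
  have hfinA : Module.finrank ℚ A = m * (q - 1) := by
    rw [IsCyclotomicExtension.finrank (n := 2 * m * q) A (cyclotomic.irreducible_rat (by positivity)),
      Nat.totient_mul hcop, Nat.totient_prime hq, hm, show 2 * 2 ^ a = 2 ^ (a + 1) by ring,
      Nat.totient_prime_pow Nat.prime_two (by omega)]
    simp
  -- `ℚ[η] ⊆ V`
  set b : Fin m × Fin (q - 1) → ℂ := fun rs => ω ^ (rs.1 : ℕ) * ζ ^ (rs.2 : ℕ) with hb
  have hAV : Subalgebra.toSubmodule A ≤ Submodule.span ℚ (Set.range b) := by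
    rw [hA, Algebra.adjoin_eq_span, Submodule.span_le]
    intro x hx
    obtain ⟨n, rfl⟩ := Submonoid.mem_closure_singleton.1 hx
    rw [mul_pow]
    exact pow_mul_pow_mem_span hω hm0 hζ hq1 n n
  -- dimension count
  haveI : Module.Finite ℚ (Submodule.span ℚ (Set.range b)) := Module.Finite.span_of_finite ℚ (Set.finite_range b)
  rw [linearIndependent_iff_card_eq_finrank_span, Fintype.card_prod, Fintype.card_fin, Fintype.card_fin]
  refine le_antisymm ?_ (by simpa using finrank_range_le_card (R := ℚ) b)
  calc m * (q - 1) = Module.finrank ℚ (Subalgebra.toSubmodule A) := by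
        rw [Subalgebra.finrank_toSubmodule, hfinA]
    _ ≤ (Set.range b).finrank ℚ := Submodule.finrank_mono hAV

/-- **A vanishing combination `Σ_{r<m} Σ_{s<q} c_{rs} ω^r ζ^s = 0` has `s ↦ c_{rs}` CONSTANT for every `r < m`.**
(Substitute `ζ^{q-1} = -Σ_{s<q-1} ζ^s` and use the independence of the basic monomials.)
[cite: Washington1997, Prop. 2.4] -/
theorem forall_eq_of_sum_monomials_eq_zero (hm : m = 2 ^ a) (hω : ω ^ m = -1) (hq : q.Prime) (hq2 : q ≠ 2)
    (hζ : IsPrimitiveRoot ζ q) (c : ℕ → ℕ → ℚ)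
    (h0 : ∑ r ∈ Finset.range m, ∑ s ∈ Finset.range q, (c r s : ℂ) * (ω ^ r * ζ ^ s) = 0) :
    ∀ r < m, ∀ s < q, c r s = c r (q - 1) := by
  classical
  have hq1 : 1 < q := hq.one_lt
  have hζtop : ζ ^ (q - 1) = -∑ s ∈ Finset.range (q - 1), ζ ^ s := by
    have h := hζ.geom_sum_eq_zero hq1
    rw [show q = (q - 1) + 1 by omega, Finset.sum_range_succ] at h
    linear_combination h
  -- rewrite the relation on the basic monomials with coefficients `c r s - c r (q-1)`
  have h1 : ∑ r ∈ Finset.range m, ∑ s ∈ Finset.range (q - 1),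
      ((c r s - c r (q - 1) : ℚ) : ℂ) * (ω ^ r * ζ ^ s) = 0 := by
    rw [← h0]
    refine Finset.sum_congr rfl fun r _ => ?_
    rw [show q = (q - 1) + 1 by omega, Finset.sum_range_succ, Nat.add_sub_cancel, hζtop, mul_neg,
      Finset.mul_sum, mul_neg, Finset.mul_sum, ← Finset.sum_neg_distrib, ← Finset.sum_add_distrib]
    refine Finset.sum_congr rfl fun s _ => ?_
    push_cast
    ring
  have hli := linearIndependent_monomials hm hω hq hq2 hζ
  rw [Fintype.linearIndependent_iff] at hli
  have h2 : ∑ rs : Fin m × Fin (q - 1),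
      ((c rs.1 rs.2 - c rs.1 (q - 1) : ℚ)) • (ω ^ (rs.1 : ℕ) * ζ ^ (rs.2 : ℕ)) = 0 := by
    rw [← h1, Fintype.sum_prod_type, Finset.sum_range]
    refine Finset.sum_congr rfl fun r _ => ?_
    rw [Finset.sum_range]
    refine Finset.sum_congr rfl fun s _ => ?_
    rw [Rat.smul_def]
  intro r hr s hs
  rcases Nat.lt_or_ge s (q - 1) with hs' | hs'
  · have h3 := hli _ h2 (⟨r, hr⟩, ⟨s, hs'⟩)
    exact sub_eq_zero.1 h3
  · rw [show s = q - 1 by omega]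

end Monomials

end Summit.HodgeConjecture.CorCM.CyclicTwoPower

end
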